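import Summits.ValiantsHypothesis.ValiantsHypothesis.Theorems.BarrierLeverChowBenchmarkPairsWindowCertF
import Summits.ValiantsHypothesis.ValiantsHypothesis.Theorems.BarrierLeverChowBenchmarkPairsWindowCertG
import Summits.ValiantsHypothesis.ValiantsHypothesis.Theorems.BarrierLeverChowBenchmarkPairsWindowCertH
import Summits.ValiantsHypothesis.ValiantsHypothesis.Theorems.BarrierLeverChowBenchmarkPairsWindowCertI
import Summits.ValiantsHypothesis.ValiantsHypothesis.Theorems.BarrierLeverPartitionMinorsMooreBenchCPM

/-!
# Route BarrierLever — item 22038 `ChowBenchmarkPairs`, line `moore_peel`: registered stub `stub_window`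
# (THE CERTIFIED WINDOW `h ≤ 182` of MC-bench(s = 2)), kernel-proved

Helper file (`--supports stmt-ValiantsHypothesis-22038`; cell val-lit, seat val-lit-p5 g9; rung V4, 𝒟-side benchmark
of record, registered line `Cruxes/ChowBenchmarkPairs/Lines/moore_peel.lean`, skeleton bfe926c0).  Closes NO item
(the item's ∀h content is the other stub, `stub_segmentMeanValue`, OPEN).

Assembly: Theorem A (`mcBenchPairsAt_of_peel`, natproofs-prover g14) reduces `MCBenchPairsAt h` to
`det (peelMatrix i) ≠ 0` for `1 ≤ i ≤ h`; the determinants are certified for `i ≤ 52` by the inverse-data files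
`…MooreBenchSmall/CertA–E` (natproofs-prover g14) and for `53 ≤ i ≤ 182` by the block-triangular kernel certificates
of `…WindowCertF/G/H/I` (this seat; soundness `…WindowCertDefs/BTF`).  Hence:

* **`det_peelMatrix_ne_zero_of_le_182`**, **`mcBenchPairsAt_of_le_182`** — MC-bench(s = 2) at every height `h ≤ 182`;
* **`stub_window : Stmt.stub_window`** — the registered stub BY NAME (`Stmt.stub_window := ∀ h ≤ 182, MCBenchPairsAt h`,
  restated verbatim in `…WindowCertBTF`; by-name credit recipe of planner natproofs-p1 g19);
* **`chowBenchmarkPairs_of_le_182`** — the ITEM's statement (route decl `Theses.BarrierLever.ChowBenchmarkPairs`,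
  filter form of the binary-code columns, free node table `B`) at every height `h ≤ 182`, unconditionally;
* `chow_hit_pairs_of_le_182` — the same as a product of `h + h` affine forms (door of item 20172).

`h = 182` is where this method stops: `det G_183 = 0` (Möbius coincidence of the factorial zeta matrix; MEMO-g18 §4),
so Theorem A is inconclusive from `h = 183` on — the heights beyond are the business of `stub_segmentMeanValue`.

WHAT THIS IS NOT: not the item (∀h); nothing on items 19717 / 14610, on crux `SuccinctHittingSetsForVP`, or on
`VP` versus `VNP` (which is NOT proved; a 𝒟-side benchmark window is method validation, not progress on it).
-/

set_option linter.dupNamespace false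

namespace Summit.ValiantsHypothesis.ValiantsHypothesis.Theorems.BarrierLever.MoorePeel

/-- **The stage determinants `det G_i`, `1 ≤ i ≤ 182`, are all nonzero** (`i ≤ 52`: inverse-data certificates
`…CertA–E`; `53 ≤ i ≤ 182`: block-triangular certificates `…WindowCertF–I`). -/
theorem det_peelMatrix_ne_zero_of_le_182 (i : ℕ) (hi : 1 ≤ i) (hi' : i ≤ 182) : (peelMatrix i).det ≠ 0 := by
  by_cases h52 : i ≤ 52
  · exact det_peelMatrix_ne_zero_of_le_52 i hi h52
  by_cases h95 : i ≤ 95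
  · exact det_peelMatrix_ne_zero_band_53_95 i (by omega) h95
  by_cases h130 : i ≤ 130
  · exact det_peelMatrix_ne_zero_band_96_130 i (by omega) h130
  by_cases h158 : i ≤ 158
  · exact det_peelMatrix_ne_zero_band_131_158 i (by omega) h158
  · exact det_peelMatrix_ne_zero_band_159_182 i (by omega) hi'

/-- **MC-bench(s = 2) holds at every height `h ≤ 182`** (Theorem A + the 182 kernel certificates). -/
theorem mcBenchPairsAt_of_le_182 (h : ℕ) (hh : h ≤ 182) : MCBenchPairsAt h :=
  mcBenchPairsAt_of_peel h fun i hi hih => det_peelMatrix_ne_zero_of_le_182 i hi (hih.trans hh)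

/-- **Registered stub `stub_window` of the line `moore_peel` (item 22038), BY NAME**: the certified window
`∀ h ≤ 182, MCBenchPairsAt h`. -/
theorem stub_window : Stmt.stub_window := fun h hh => mcBenchPairsAt_of_le_182 h hh

/-- **The item `ChowBenchmarkPairs` at every height `h ≤ 182`, unconditionally** — its statement verbatim (columns =
binary codes in the filter form of the route decl, a free node table `B : Fin h → Fin h → ℂ`), witnessed by the
Moore–Chow nodes `B a c = Y_a ^ 2^c`. -/
theorem chowBenchmarkPairs_of_le_182 (h : ℕ) (hh : h ≤ 182) (r : ℕ) (u : Fin r → Finset (Fin h))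
    (hu : Function.Injective u) (hcard : ∀ i, (u i).card ≤ 2)
    (hsurj : ∀ S : Finset (Fin h), S.card ≤ 2 → ∃ i, u i = S) :
    ∃ B : Fin h → Fin h → ℂ,
      (Matrix.of fun i j : Fin r => MvPolynomial.coeff
        (∑ a ∈ u i, Finsupp.single (Fin.castAdd h a) 1 +
          ∑ c ∈ Finset.univ.filter (fun c : Fin h => Nat.testBit (j : ℕ) (c : ℕ)),
            Finsupp.single (Fin.natAdd h c) 1)
        (∏ a : Fin h, (MvPolynomial.X (Fin.castAdd h a) + 1 +
          ∑ c : Fin h, MvPolynomial.C (B a c) * MvPolynomial.X (Fin.natAdd h c)))).det ≠ 0 := by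
  obtain ⟨Y, hY⟩ := mcBenchPairsAt_of_le_182 h hh r u hu hcard hsurj
  exact ⟨fun a c => Y a ^ 2 ^ (c : ℕ), by simpa only [mooreChowFactor, benchCols] using hY⟩

/-- The window in the currency of item 20172's door: at every height `h ≤ 182` the benchmark layout is hit by a
product of `h + h` affine forms. -/
theorem chow_hit_pairs_of_le_182 (h : ℕ) (hh : h ≤ 182) (r : ℕ) (u : Fin r → Finset (Fin h))
    (hu : Function.Injective u) (hcard : ∀ i, (u i).card ≤ 2)
    (hsurj : ∀ S : Finset (Fin h), S.card ≤ 2 → ∃ i, u i = S) :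
    ∃ ℓ : Fin (h + h) → MvPolynomial (Fin (h + h)) ℂ, (∀ k, (ℓ k).totalDegree ≤ 1) ∧
      (Matrix.of fun i j : Fin r => MvPolynomial.coeff
        (∑ a ∈ u i, Finsupp.single (Fin.castAdd h a) 1 +
          ∑ c ∈ benchCols h r j, Finsupp.single (Fin.natAdd h c) 1)
        (∏ k, ℓ k)).det ≠ 0 :=
  chow_hit_of_mcBenchPairsAt h (mcBenchPairsAt_of_le_182 h hh) r u hu hcard hsurj

end Summit.ValiantsHypothesis.ValiantsHypothesis.Theorems.BarrierLever.MoorePeel
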